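import Summits.Langlands.Langlands.Theses.RepeatedRootSocle
import Literature.NumberTheory.GaloisRepresentations.SymplecticMultiplierDeterminant
import Literature.NumberTheory.GaloisRepresentations.LocalKroneckerWeberInertiaProofs
import Literature.NumberTheory.EllipticCurves.InertiaAboveEllCyclotomicProofs
import Literature.NumberTheory.EllipticCurves.BSDConductorProofs

/-!
# `LimitClassicalUnrefined` (stmt-Langlands-18087): the hypothesis bracket `Sympl ∧ PSh` is unsatisfiable

Negative-side lemma (crux-attack at birth `rattack-stmt-Langlands-18087`, 2026-08-17; supports
stmt-Langlands-18087; workfile `Cruxes/LimitClassicalUnrefined/Disproof.lean` §1–§2).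

The bracket shared by `RepeatedRootSocle.LimitClassicalUnrefined`, `.UnrefinedWeightTwoLifting` and
`.PadicLimitUnrefined` asks `ρ : Γ_ℚ → GL₄(ℚ̄_p)` to be symplectic with multiplier `ε⁻¹`
(cohomological convention: `det ρ = ε⁻²`, `IsSymplecticWithMultiplierFun.det_eq_sq`) AND, at the
place `v ∣ p`, conjugate to the HOMOLOGICAL Siegel shape with diagonal `(εα, εβ, β⁻¹, α⁻¹)`
(`det = ε²`, `det_toLocal_of_siegelShape`).  Hence `ε⁴ = 1` on `Γ_{ℚ_v}`, contradicting
`χ_p(I_{ℚ_v}) = ℤ_pˣ ∋ 1 + p`: `false_of_sympl_inv_of_siegelShape`.  So all three items hold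
vacuously and must be restated; the repaired (cohomological) shape `(α, β, ε⁻¹β⁻¹, ε⁻¹α⁻¹)` passes
the same determinant test (`det_toLocal_of_cohomologicalSiegelShape`).  No definition, no named fact.
-/

set_option linter.dupNamespace false -- `Summit.Langlands.Langlands` is the mandated namespace (D-0017)

open scoped NumberField MatrixGroups Matrix
open Field IsDedekindDomain
open Literature.NumberTheory.GaloisRepresentations

namespace Summit.Langlands.Langlands.Theorems.LimitClassicalUnrefined.Negative

variable {p : ℕ} [Fact p.Prime]

/-! ## §1 The bracket `Sympl ∧ PSh` is contradictory -/

/-- In the homological Siegel shape (the route's `PSh`) the determinant on `Γ_{ℚ_v}` is `ε²`.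
[folklore] -/
theorem det_toLocal_of_siegelShape (ρ : FramedGaloisRep ℚ (PadicAlgCl p) 4)
    (v : HeightOneSpectrum (𝓞 ℚ))
    (h : ∃ (g : Matrix.GeneralLinearGroup (Fin 4) (PadicAlgCl p))
      (α β : absoluteGaloisGroup (v.adicCompletion ℚ) →* (PadicAlgCl p)ˣ),
      (∀ τ ∈ absInertia (v.adicCompletion ℚ), α τ = 1 ∧ β τ = 1) ∧
      ∀ τ, (∀ i j : Fin 4, j < i → (g⁻¹ * ρ.toLocal v τ * g).val i j = 0) ∧
        (g⁻¹ * ρ.toLocal v τ * g).val 0 1 = 0 ∧ (g⁻¹ * ρ.toLocal v τ * g).val 2 3 = 0 ∧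
        (g⁻¹ * ρ.toLocal v τ * g).val 0 0 =
          algebraMap ℚ_[p] (PadicAlgCl p)
            (((GaloisRep.cyclotomicCharacter (v.adicCompletion ℚ) p τ : ℤ_[p]ˣ) : ℤ_[p]) :
              ℚ_[p]) * α τ ∧
        (g⁻¹ * ρ.toLocal v τ * g).val 1 1 =
          algebraMap ℚ_[p] (PadicAlgCl p)
            (((GaloisRep.cyclotomicCharacter (v.adicCompletion ℚ) p τ : ℤ_[p]ˣ) : ℤ_[p]) :
              ℚ_[p]) * β τ ∧
        (g⁻¹ * ρ.toLocal v τ * g).val 2 2 = ((β τ)⁻¹ : (PadicAlgCl p)ˣ) ∧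
        (g⁻¹ * ρ.toLocal v τ * g).val 3 3 = ((α τ)⁻¹ : (PadicAlgCl p)ˣ))
    (τ : absoluteGaloisGroup (v.adicCompletion ℚ)) :
    ((ρ.toLocal v τ : GL (Fin 4) (PadicAlgCl p)) : Matrix (Fin 4) (Fin 4) (PadicAlgCl p)).det =
      algebraMap ℚ_[p] (PadicAlgCl p)
        (((GaloisRep.cyclotomicCharacter (v.adicCompletion ℚ) p τ : ℤ_[p]ˣ) : ℤ_[p]) : ℚ_[p]) ^ 2 := by
  obtain ⟨g, α, β, -, hsh⟩ := h
  obtain ⟨htri, -, -, h₀, h₁, h₂, h₃⟩ := hsh τ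
  have hdet : Matrix.GeneralLinearGroup.det (ρ.toLocal v τ) =
      Matrix.GeneralLinearGroup.det (g⁻¹ * ρ.toLocal v τ * g) := by
    rw [map_mul, map_mul, map_inv, inv_mul_cancel_comm]
  have hup : ((g⁻¹ * ρ.toLocal v τ * g : GL (Fin 4) (PadicAlgCl p)) :
      Matrix (Fin 4) (Fin 4) (PadicAlgCl p)).BlockTriangular id :=
    fun i j hij => htri i j hij
  have hval : ((ρ.toLocal v τ : GL (Fin 4) (PadicAlgCl p)) :
      Matrix (Fin 4) (Fin 4) (PadicAlgCl p)).det =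
      ((g⁻¹ * ρ.toLocal v τ * g : GL (Fin 4) (PadicAlgCl p)) :
        Matrix (Fin 4) (Fin 4) (PadicAlgCl p)).det := by
    rw [← Matrix.GeneralLinearGroup.val_det_apply, ← Matrix.GeneralLinearGroup.val_det_apply, hdet]
  rw [hval, Matrix.det_of_upperTriangular hup, Fin.prod_univ_four, h₀, h₁, h₂, h₃]
  set e : PadicAlgCl p := algebraMap ℚ_[p] (PadicAlgCl p)
    (((GaloisRep.cyclotomicCharacter (v.adicCompletion ℚ) p τ : ℤ_[p]ˣ) : ℤ_[p]) : ℚ_[p]) with he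
  calc e * α τ * (e * β τ) * ((β τ)⁻¹ : (PadicAlgCl p)ˣ) * ((α τ)⁻¹ : (PadicAlgCl p)ˣ)
      = e ^ 2 * ((α τ : PadicAlgCl p) * ((α τ)⁻¹ : (PadicAlgCl p)ˣ)) *
          ((β τ : PadicAlgCl p) * ((β τ)⁻¹ : (PadicAlgCl p)ˣ)) := by ring
    _ = e ^ 2 := by rw [Units.mul_inv, Units.mul_inv, mul_one, mul_one]

/-- **The bracket `Sympl ρ ∧ (∀ v ∣ p, PSh ρ v)` of the route is unsatisfiable** ("any `ρ`
satisfying the crux's hypotheses" does not exist): multiplier `ε⁻¹` forces `det ρ = ε⁻²`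
(`GSp₄`: `det = ν²`), the homological Siegel shape forces `det ρ|Γ_{ℚ_p} = ε²`, so `ε⁴ = 1` on
`Γ_{ℚ_p}`, absurd since `χ_p(I_{ℚ_p}) = ℤ_pˣ ∋ 1 + p`. [folklore] -/
theorem false_of_sympl_inv_of_siegelShape (ρ : FramedGaloisRep ℚ (PadicAlgCl p) 4)
    (hS : ρ.IsSymplecticWithMultiplierFun (fun g => algebraMap ℚ_[p] (PadicAlgCl p)
      ((((GaloisRep.cyclotomicCharacter ℚ p g)⁻¹ : ℤ_[p]ˣ) : ℤ_[p]) : ℚ_[p])))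
    (hP : ∀ v : HeightOneSpectrum (𝓞 ℚ), ((p : ℕ) : 𝓞 ℚ) ∈ v.asIdeal →
      ∃ (g : Matrix.GeneralLinearGroup (Fin 4) (PadicAlgCl p))
        (α β : absoluteGaloisGroup (v.adicCompletion ℚ) →* (PadicAlgCl p)ˣ),
        (∀ τ ∈ absInertia (v.adicCompletion ℚ), α τ = 1 ∧ β τ = 1) ∧
        ∀ τ, (∀ i j : Fin 4, j < i → (g⁻¹ * ρ.toLocal v τ * g).val i j = 0) ∧
          (g⁻¹ * ρ.toLocal v τ * g).val 0 1 = 0 ∧ (g⁻¹ * ρ.toLocal v τ * g).val 2 3 = 0 ∧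
          (g⁻¹ * ρ.toLocal v τ * g).val 0 0 =
            algebraMap ℚ_[p] (PadicAlgCl p)
              (((GaloisRep.cyclotomicCharacter (v.adicCompletion ℚ) p τ : ℤ_[p]ˣ) : ℤ_[p]) :
                ℚ_[p]) * α τ ∧
          (g⁻¹ * ρ.toLocal v τ * g).val 1 1 =
            algebraMap ℚ_[p] (PadicAlgCl p)
              (((GaloisRep.cyclotomicCharacter (v.adicCompletion ℚ) p τ : ℤ_[p]ˣ) : ℤ_[p]) :
                ℚ_[p]) * β τ ∧
          (g⁻¹ * ρ.toLocal v τ * g).val 2 2 = ((β τ)⁻¹ : (PadicAlgCl p)ˣ) ∧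
          (g⁻¹ * ρ.toLocal v τ * g).val 3 3 = ((α τ)⁻¹ : (PadicAlgCl p)ˣ)) :
    False := by
  have hp : p.Prime := Fact.out
  -- the place of `ℚ` above `p`
  obtain ⟨v, hv, hpv⟩ : ∃ v : HeightOneSpectrum (𝓞 ℚ),
      ((Rat.HeightOneSpectrum.primesEquiv v : Nat.Primes) : ℕ) = p ∧
        ((p : ℕ) : 𝓞 ℚ) ∈ v.asIdeal := by
    refine ⟨(Rat.HeightOneSpectrum.primesEquiv (R := 𝓞 ℚ)).symm ⟨p, hp⟩, ?_, ?_⟩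
    · rw [Equiv.apply_symm_apply]
    · exact (Literature.NumberTheory.EllipticCurves.natCast_mem_asIdeal_iff_eq_primesEquiv_symm
        _ hp).mpr rfl
  -- a unit of infinite order, carried by an element of `Γ_{ℚ_v}`
  obtain ⟨u, hu⟩ := exists_unit_pow_ne_one p
  obtain ⟨τ, -, hτ⟩ := adicCompletion_rat_exists_mem_absInertia_cyclotomicCharacter_eq p v hv u
  -- the determinant of `ρ(τ)` computed in two ways
  have h1 := det_toLocal_of_siegelShape ρ v (hP v hpv) τ
  rw [FramedGaloisRep.toLocal_apply] at h1
  haveI : NeZero ((p : ℕ) : ℚ) := ⟨by exact_mod_cast hp.ne_zero⟩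
  have h2 := hS.det_eq_sq (absGaloisRestrict ℚ (v.adicCompletion ℚ) τ)
  rw [h1, cyclotomicCharacter_absGaloisRestrict, hτ] at h2
  -- read everything through `F : ℤ_p → ℚ̄_p`
  obtain ⟨F, hF⟩ : ∃ F : ℤ_[p] →+* PadicAlgCl p,
      ∀ x : ℤ_[p], F x = algebraMap ℚ_[p] (PadicAlgCl p) (x : ℚ_[p]) :=
    ⟨(algebraMap ℚ_[p] (PadicAlgCl p)).comp PadicInt.Coe.ringHom, fun x => rfl⟩
  have hFinj : Function.Injective F := fun a b h => by
    rw [hF, hF] at h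
    exact PadicInt.ext ((algebraMap ℚ_[p] (PadicAlgCl p)).injective h)
  rw [← hF, ← hF] at h2
  -- `h2 : F u ^ 2 = F u⁻¹ ^ 2`, hence `F u ^ 4 = 1`
  have hmul : F (u : ℤ_[p]) * F ((u⁻¹ : ℤ_[p]ˣ) : ℤ_[p]) = 1 := by
    rw [← map_mul, Units.mul_inv, map_one]
  have key : F (u : ℤ_[p]) ^ 4 = 1 := by
    calc F (u : ℤ_[p]) ^ 4 = F (u : ℤ_[p]) ^ 2 * F (u : ℤ_[p]) ^ 2 := by ring
      _ = F (u : ℤ_[p]) ^ 2 * F ((u⁻¹ : ℤ_[p]ˣ) : ℤ_[p]) ^ 2 := by rw [← h2]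
      _ = (F (u : ℤ_[p]) * F ((u⁻¹ : ℤ_[p]ˣ) : ℤ_[p])) ^ 2 := by ring
      _ = 1 := by rw [hmul, one_pow]
  have h5 : ((u ^ 4 : ℤ_[p]ˣ) : ℤ_[p]) = 1 :=
    hFinj (by rw [Units.val_pow_eq_pow_val, map_pow, key, map_one])
  exact hu 4 (by norm_num) (Units.ext (by rw [h5, Units.val_one]))

/-! ## §2 The repaired bracket (cohomological Siegel shape) passes the determinant test -/

/-- In the COHOMOLOGICAL Siegel shape (BCGP 2021 Def. 7.3.1 as printed, residual distinctness
dropped: diagonal `(α, β, ε⁻¹β⁻¹, ε⁻¹α⁻¹)`) the determinant on `Γ_{ℚ_v}` is `ε⁻² = (ε⁻¹)²` — the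
square of the multiplier `ε⁻¹`: the repaired bracket `C′` is consistent where the original dies.
[folklore] -/
theorem det_toLocal_of_cohomologicalSiegelShape (ρ : FramedGaloisRep ℚ (PadicAlgCl p) 4)
    (v : HeightOneSpectrum (𝓞 ℚ))
    (h : ∃ (g : Matrix.GeneralLinearGroup (Fin 4) (PadicAlgCl p))
      (α β : absoluteGaloisGroup (v.adicCompletion ℚ) →* (PadicAlgCl p)ˣ),
      (∀ τ ∈ absInertia (v.adicCompletion ℚ), α τ = 1 ∧ β τ = 1) ∧
      ∀ τ, (∀ i j : Fin 4, j < i → (g⁻¹ * ρ.toLocal v τ * g).val i j = 0) ∧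
        (g⁻¹ * ρ.toLocal v τ * g).val 0 1 = 0 ∧ (g⁻¹ * ρ.toLocal v τ * g).val 2 3 = 0 ∧
        (g⁻¹ * ρ.toLocal v τ * g).val 0 0 = α τ ∧
        (g⁻¹ * ρ.toLocal v τ * g).val 1 1 = β τ ∧
        (g⁻¹ * ρ.toLocal v τ * g).val 2 2 =
          algebraMap ℚ_[p] (PadicAlgCl p)
            ((((GaloisRep.cyclotomicCharacter (v.adicCompletion ℚ) p τ)⁻¹ : ℤ_[p]ˣ) : ℤ_[p]) :
              ℚ_[p]) * ((β τ)⁻¹ : (PadicAlgCl p)ˣ) ∧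
        (g⁻¹ * ρ.toLocal v τ * g).val 3 3 =
          algebraMap ℚ_[p] (PadicAlgCl p)
            ((((GaloisRep.cyclotomicCharacter (v.adicCompletion ℚ) p τ)⁻¹ : ℤ_[p]ˣ) : ℤ_[p]) :
              ℚ_[p]) * ((α τ)⁻¹ : (PadicAlgCl p)ˣ))
    (τ : absoluteGaloisGroup (v.adicCompletion ℚ)) :
    ((ρ.toLocal v τ : GL (Fin 4) (PadicAlgCl p)) : Matrix (Fin 4) (Fin 4) (PadicAlgCl p)).det =
      algebraMap ℚ_[p] (PadicAlgCl p)
        ((((GaloisRep.cyclotomicCharacter (v.adicCompletion ℚ) p τ)⁻¹ : ℤ_[p]ˣ) : ℤ_[p]) :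
          ℚ_[p]) ^ 2 := by
  obtain ⟨g, α, β, -, hsh⟩ := h
  obtain ⟨htri, -, -, h₀, h₁, h₂, h₃⟩ := hsh τ
  have hdet : Matrix.GeneralLinearGroup.det (ρ.toLocal v τ) =
      Matrix.GeneralLinearGroup.det (g⁻¹ * ρ.toLocal v τ * g) := by
    rw [map_mul, map_mul, map_inv, inv_mul_cancel_comm]
  have hup : ((g⁻¹ * ρ.toLocal v τ * g : GL (Fin 4) (PadicAlgCl p)) :
      Matrix (Fin 4) (Fin 4) (PadicAlgCl p)).BlockTriangular id :=
    fun i j hij => htri i j hij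
  have hval : ((ρ.toLocal v τ : GL (Fin 4) (PadicAlgCl p)) :
      Matrix (Fin 4) (Fin 4) (PadicAlgCl p)).det =
      ((g⁻¹ * ρ.toLocal v τ * g : GL (Fin 4) (PadicAlgCl p)) :
        Matrix (Fin 4) (Fin 4) (PadicAlgCl p)).det := by
    rw [← Matrix.GeneralLinearGroup.val_det_apply, ← Matrix.GeneralLinearGroup.val_det_apply, hdet]
  rw [hval, Matrix.det_of_upperTriangular hup, Fin.prod_univ_four, h₀, h₁, h₂, h₃]
  set e' : PadicAlgCl p := algebraMap ℚ_[p] (PadicAlgCl p)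
    ((((GaloisRep.cyclotomicCharacter (v.adicCompletion ℚ) p τ)⁻¹ : ℤ_[p]ˣ) : ℤ_[p]) : ℚ_[p])
    with he'
  calc (α τ : PadicAlgCl p) * β τ * (e' * ((β τ)⁻¹ : (PadicAlgCl p)ˣ)) *
        (e' * ((α τ)⁻¹ : (PadicAlgCl p)ˣ))
      = e' ^ 2 * ((α τ : PadicAlgCl p) * ((α τ)⁻¹ : (PadicAlgCl p)ˣ)) *
          ((β τ : PadicAlgCl p) * ((β τ)⁻¹ : (PadicAlgCl p)ˣ)) := by ring
    _ = e' ^ 2 := by rw [Units.mul_inv, Units.mul_inv, mul_one, mul_one]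

end Summit.Langlands.Langlands.Theorems.LimitClassicalUnrefined.Negative
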